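import Summits.QuantumFields.BalabanUV.T4Continuum.Support.AveragingDeficitSideDeriv
import Literature.MathematicalPhysics.QuantumFieldTheory.Balaban1983to89.B7BlockAvgLog
import HarnessLib

/-!
# NE7CommutingLogDerivative — THE LOGARITHM OF A COMMUTING PRODUCT AND THE DUHAMEL KERNEL IN THE COMMUTING SECTOR:
# `log (u·e^{c}) = log u + c`, `d/ds|₀ log (u·e^{sc}) = c`, `J_X(Y) = Y` when the arguments commute

Lineage `b2b-balaban-t4-ne7-p1` (CRUX PROVER NE7 #1 = OWNER of BINDER row NE7), generation 116 — second brick of ROAD-G116 §7 (G-ab) «the abelian sector of the curved positivity».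
The linearisation `pushDir` of Bałaban's average (42) (✓ `AveragingDeficitSideDeriv`: `sideDeriv = Ad_{e^{X_c}}(J_{X_c}(X_c′) + δV(Γ_c))`, `X_c′ = Σ_x L^{−d}·d/ds|₀ log W_{c,x}[V e^{sψ}]`) reduces
to the flat `Tside` when the data COMMUTE because (i) the Duhamel kernel `J_X(Y) = ∫₀¹ e^{−rX} Y e^{rX} dr` is the identity on the commutant of `X` and (ii) the logarithmic series
(21) is additive on commuting products inside its ball.  THIS FILE proves exactly these two analytic facts, for a complete normed `ℂ`-algebra `𝔸` ([folklore]; 0 def, 0 sorry):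
* **`mlog_mul_exp_of_commute`**: `‖u − 1‖ < 1`, `Commute u c`, `‖log u + c‖ < ln 2` ⟹ `mlog (u * exp c) = mlog u + c` (✓ `B7BlockAvgLog.commute_mlog_right`, `exp_add_of_commute`,
  ✓ `MatrixLog.exp_mlog`, ✓ `B7BlockAvgLog.mlog_exp`);
* **`hasDerivAt_mlog_mul_exp_smul`**: `‖u − 1‖ < 1`, `‖log u‖ < ln 2`, `Commute u c` ⟹ `HasDerivAt (s ↦ mlog (u * exp (s • c))) c 0`;
* **`jexp_of_commute`** (matrices): `Commute X Y ⟹ jexp X Y = Y`.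
HONEST FRAMING: elementary analysis in a Banach algebra under explicit commutation hypotheses; nothing about Bałaban's minimisers; NOT NE7 as a spine node; spine 0∕9; NOT infinite
volume, NOT mass gap, NOT BetaPertH, NOT Clay.
-/

set_option autoImplicit false

open scoped BigOperators Matrix Matrix.Norms.L2Operator Topology
open NormedSpace Filter

namespace Summit.QuantumFields.BalabanUV.T4Continuum.NE7CommutingLogDerivative

open Literature.MathematicalPhysics.QuantumFieldTheory.Balaban1983to89
open MatrixLog (mlog exp_mlog)
open B7BlockAvgLog (mlog_exp commute_mlog_right)
open AveragingDeficitSideDeriv (jexp)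

noncomputable section

/-! ## §1 The logarithm of a commuting product -/

section Algebra

variable {𝔸 : Type*} [NormedRing 𝔸] [NormedAlgebra ℂ 𝔸] [CompleteSpace 𝔸]

/-- **`log (u·e^{c}) = log u + c`** for commuting `u`, `c` inside the balls of the series (`‖u − 1‖ < 1`, `‖log u + c‖ < ln 2`). [folklore] -/
theorem mlog_mul_exp_of_commute {u c : 𝔸} (hu : ‖u - 1‖ < 1) (hc : Commute u c) (hs : ‖mlog u + c‖ < Real.log 2) :
    mlog (u * exp c) = mlog u + c := by
  letI : NormedAlgebra ℚ 𝔸 := NormedAlgebra.restrictScalars ℚ ℂ 𝔸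
  have hcomm : Commute (mlog u) c := (commute_mlog_right hc.symm).symm
  have hprod : u * exp c = exp (mlog u + c) := by
    rw [exp_add_of_commute hcomm, exp_mlog hu]
  rw [hprod, mlog_exp hs]

/-- **`d/ds|₀ log (u·e^{sc}) = c`** for commuting `u`, `c` with `‖u − 1‖ < 1` and `‖log u‖ < ln 2`: near `s = 0` the function IS `s ↦ log u + s c`. [folklore] -/
theorem hasDerivAt_mlog_mul_exp_smul {u c : 𝔸} (hu : ‖u - 1‖ < 1) (hlog : ‖mlog u‖ < Real.log 2) (hc : Commute u c) :
    HasDerivAt (fun s : ℝ => mlog (u * exp ((s : ℂ) • c))) c 0 := by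
  -- the affine model and its derivative
  have hlin : HasDerivAt (fun s : ℝ => mlog u + (s : ℂ) • c) c 0 := by
    have h := ((Complex.ofRealCLM.hasDerivAt (x := (0 : ℝ))).smul_const c).const_add (mlog u)
    simpa using h
  refine hlin.congr_of_eventuallyEq ?_
  -- near `0` the two functions agree
  have hgap : 0 < Real.log 2 - ‖mlog u‖ := by linarith
  have hev : ∀ᶠ s : ℝ in 𝓝 0, |s| * ‖c‖ < Real.log 2 - ‖mlog u‖ := by
    have hcont : Continuous fun s : ℝ => |s| * ‖c‖ := continuous_abs.mul continuous_const
    have h0 : (fun s : ℝ => |s| * ‖c‖) 0 < Real.log 2 - ‖mlog u‖ := by simpa using hgap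
    exact hcont.continuousAt.eventually_lt continuousAt_const h0
  filter_upwards [hev] with s hs
  have hsc : Commute u ((s : ℂ) • c) := hc.smul_right _
  have hbound : ‖mlog u + (s : ℂ) • c‖ < Real.log 2 := by
    calc ‖mlog u + (s : ℂ) • c‖ ≤ ‖mlog u‖ + ‖(s : ℂ) • c‖ := norm_add_le _ _
      _ = ‖mlog u‖ + |s| * ‖c‖ := by rw [norm_smul, Complex.norm_real, Real.norm_eq_abs]
      _ < Real.log 2 := by linarith
  exact mlog_mul_exp_of_commute hu hsc hbound

end Algebra

/-! ## §2 The Duhamel kernel on the commutant -/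

section Matrices

variable {n : Type*} [Fintype n] [DecidableEq n]

/-- **`J_X(Y) = Y` when `X` and `Y` commute**: the Duhamel kernel `∫₀¹ e^{−rX} Y e^{rX} dr` is the identity on the commutant of `X`. [folklore] -/
theorem jexp_of_commute {X Y : Matrix n n ℂ} (h : Commute X Y) : jexp X Y = Y := by
  letI : NormedAlgebra ℚ (Matrix n n ℂ) := NormedAlgebra.restrictScalars ℚ ℂ (Matrix n n ℂ)
  have hint : ∀ r : ℝ, exp (-(r • X)) * Y * exp (r • X) = Y := by
    intro r
    have hc : Commute (exp (-(r • X))) Y := ((h.smul_left r).neg_left).exp_left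
    rw [hc.eq, mul_assoc, ← exp_add_of_commute ((Commute.refl (r • X)).neg_left), neg_add_cancel, exp_zero, mul_one]
  unfold jexp
  simp_rw [hint]
  rw [intervalIntegral.integral_const, sub_zero, one_smul]

end Matrices

end

end Summit.QuantumFields.BalabanUV.T4Continuum.NE7CommutingLogDerivative
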